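import Summits.AtomisticToContinuum.HydrodynamicLimit.Theorems.AntiMazurCoboundariesInfluenceLocalityNearChainBound
import Summits.AtomisticToContinuum.HydrodynamicLimit.Theorems.AntiMazurCoboundariesInfluenceLocalityNearChainOfChain
import Summits.AtomisticToContinuum.HydrodynamicLimit.Theorems.AntiMazurCoboundariesInfluenceLocalityTailArith
import Summits.AtomisticToContinuum.HydrodynamicLimit.Theorems.AntiMazurCoboundariesInfluenceLocalityAnchoredCovering
import Summits.AtomisticToContinuum.HydrodynamicLimit.Theorems.AntiMazurCoboundariesInfluenceLocalityTrueCapsExist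
import Summits.AtomisticToContinuum.HydrodynamicLimit.Theorems.AntiMazurCoboundariesInfluenceLocalityForecastWorldsGood
import HarnessLib

/-!
# Stub `stub_tightChainTail` of the first-moment line (crux `InfluenceLocality`, stmt-AtomisticToContinuum-13916;
# route AntiMazurCoboundaries; line `slab-percolation-shadow`, lead a1): the first-moment tight-chain tail, ASSEMBLED

The registered stub `stub_tightChainTail : TightChainTail` (objects module `…FirstMomentObjects`): eventually in `R` and
uniformly in `N ≥ N₀(R)`, the flow and the label, the `G_N`-probability that a tight anchored chain of `K ≍ R/(4σ)` links ends at
`i` while its halo is not hot is `≤ η`. TRUE FLOW ONLY (no cluster flow `Ψ`). Assembled from the three landed sub-stubs: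

* `stub_nearChainBound` (Ruelle bound for near-contact chains at one time, from `gibbs_chainEventAt_le`),
* `stub_nearChainOfChain` (slab pigeonhole over the monotone grid times + guarded-displacement pull-back to a slab end time),
* `stub_tailArith` (the stretched exponential in `√R` beats the polynomial prefactors),

through `cap_of_not_isHot` (grid-time caps are real-time caps, `mem_of_grid`), the unit bookkeeping `(N+1)ℓ³ = 1`, and the
assembly `tightChainTail_of` (`σ₀ := min σ_small (1/32)`, `S := ⌈48(w+‖u₀‖)T⌉ + 1` slabs, `r₀ := (K+1)/S − 1` forced links,
`N₀ := ⌈R/σ⌉ + ⌈64R³⌉ + 2`; the degenerate case `S > K + 1` is absorbed by the arithmetic at `r₀ = 0`).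
-/

namespace Summit.AtomisticToContinuum.HydrodynamicLimit.Theorems.TrueAnchoredInfection

open MeasureTheory Set
open scoped Classical ENNReal
open Literature.Analysis.FluidPDE Literature.MathematicalPhysics.KineticTheory

noncomputable section

/-- Real-time caps from `¬ IsHot` (grid times → all times, `mem_of_grid`): on a good datum, if no true particle is
`u`-hot at a grid time while within `R'ℓ` of `x_i(0)`, then at EVERY real time of `[0, Tℓ]` every particle within
`R'ℓ` of `x_i(0)` has relative speed `≤ u`. -/
theorem cap_of_not_isHot {σ T u R' : ℝ} {u₀ : V3} {N : ℕ} (Φ : Flow σ N) {z : Phase N} (hz : z ∈ Φ.good)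
    {i : Fin (N + 1)} (hhot : ¬ IsHot σ T N Φ u₀ u R' z i) :
    ∀ (p : Fin (N + 1)) (t : ℝ), t ∈ Set.Icc (0 : ℝ) (T * ell N) →
      Torus.euclidDist (Φ.flow t z p).1 (z i).1 < R' * ell N → ‖(Φ.flow t z p).2 - u₀‖ ≤ u := by
  intro p t ht hin
  have hO : IsOpen {y : T3 × V3 | Torus.euclidDist y.1 (z i).1 < R' * ell N} := by
    have hc : Continuous fun y : T3 × V3 => Torus.euclidDist y.1 (z i).1 := by
      have h := (Torus.continuous_euclidDist (d := Fin 3)).comp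
        ((continuous_fst (X := T3) (Y := V3)).prodMk (continuous_const (y := (z i).1)))
      simpa only [Function.comp_def] using h
    exact isOpen_lt hc continuous_const
  have hCu : IsClosed {y : T3 × V3 | ‖y.2 - u₀‖ ≤ u} := isClosed_le (by fun_prop) continuous_const
  have hgrid : ∀ q : ℚ, 0 ≤ q → q ≤ 1 →
      (fun t => Φ.flow t z) (T * ell N * q) p ∈ {y : T3 × V3 | Torus.euclidDist y.1 (z i).1 < R' * ell N} →
      (fun t => Φ.flow t z) (T * ell N * q) p ∈ {y : T3 × V3 | ‖y.2 - u₀‖ ≤ u} := by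
    intro q hq0 hq1 hqin
    by_contra hfast
    exact hhot ⟨p, q, hq0, hq1, not_le.1 hfast, hqin⟩
  exact mem_of_grid (Φ.isTrajectory z hz) p hO hCu hgrid t ht hin

/-- `(N + 1) ℓ³ = 1`. -/
theorem succ_mul_ell_pow_three (N : ℕ) : ((N : ℝ) + 1) * ell N ^ 3 = 1 := by
  rw [TrueCaps.ell_pow_three]
  field_simp

/-- `ℓ ≤ 1`. -/
theorem ell_le_one (N : ℕ) : ell N ≤ 1 := by
  have h3 : ell N ^ 3 ≤ 1 ^ 3 := by
    rw [TrueCaps.ell_pow_three, one_pow, div_le_one (by positivity)]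
    linarith
  exact le_of_pow_le_pow_left₀ (by norm_num) zero_le_one h3

/-- For `N + 1 > 64 R³` (`R ≥ 1`): `2 R ℓ < 1/2`. -/
theorem two_mul_ell_lt_half {R : ℝ} {N : ℕ} (hN : 64 * R ^ 3 < (N : ℝ) + 1) :
    2 * R * ell N < 1 / 2 := by
  have h3 : (2 * R * ell N) ^ 3 < (1 / 2 : ℝ) ^ 3 := by
    have hN0 : (0 : ℝ) < (N : ℝ) + 1 := by positivity
    have key : (2 * R * ell N) ^ 3 = 8 * R ^ 3 / ((N : ℝ) + 1) := by
      rw [mul_pow, TrueCaps.ell_pow_three]; ring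
    rw [key, div_lt_iff₀ hN0]
    nlinarith
  exact lt_of_pow_lt_pow_left₀ 3 (by norm_num) h3

/-- **ASSEMBLY OF THE CHAIN TAIL** from the three sub-stubs: `σ₀ := min σ_small (1/32)`; given a chain schedule and
`η`: `R₀ := max (R_arith, Rₐ, 1)`; `N₀ := ⌈R/σ⌉ + ⌈64R³⌉ + 2`; slabs `S := ⌈48(w+‖u₀‖)T⌉ + 1`; forced links
`r₀ := (K+1)/S − 1`. On the good set, `¬ IsHot` gives real-time caps (`cap_of_not_isHot`), the pull-back stub a slab
`s < S` with a near-contact chain at its end time, the Ruelle stub prices each slab by `4 (1/32)^{r₀}(64R³ + r₀ + 1)`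
(`(N+1)ℓ³ = 1`, `16 d³ ≤ 1/32` for `σ ≤ 1/32`), and the arithmetic stub closes; the degenerate case `S > K + 1` is
absorbed by the same arithmetic at `r₀ = 0` (`G_N ≤ 1 ≤ 4S(64R³+1) ≤ η`). -/
theorem tightChainTail_of (hB : NearChainBound) (hC : NearChainOfChain) (hA : TailArith) : TightChainTail := by
  intro a θ u₀ ha hθ
  obtain ⟨σ₁, hσ₁, hsmall⟩ := exists_smallDensity uniformProfile one_pos
  refine ⟨min σ₁ (1 / 32), by positivity, ?_⟩
  intro σ hσ hσlt T hT u w hsch η hη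
  obtain ⟨Ra, hsched⟩ := hsch
  have hσ₁' : σ < σ₁ := lt_of_lt_of_le hσlt (min_le_left _ _)
  have hσ32 : σ ≤ 1 / 32 := (le_of_lt hσlt).trans (min_le_right _ _)
  have hσhalf : σ ≤ 1 / 2 := hσ32.trans (by norm_num)
  have hsd : SmallDensity uniformProfile σ := (hsmall σ hσ hσ₁').1
  obtain ⟨R₁, hR₁, hA'⟩ := hA σ θ T ‖u₀‖ η hσ hθ hT (norm_nonneg _) hη
  refine ⟨max (max R₁ Ra) 1, lt_of_lt_of_le one_pos (le_max_right _ _), fun R hR => ?_⟩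
  have hRR₁ : R₁ ≤ R := ((le_max_left _ _).trans (le_max_left _ _)).trans hR
  have hRRa : Ra ≤ R := ((le_max_right _ _).trans (le_max_left _ _)).trans hR
  have hR1 : 1 ≤ R := (le_max_right _ _).trans hR
  have hR0 : 0 ≤ R := zero_le_one.trans hR1
  obtain ⟨hu0, huw, hwle⟩ := hsched R hRRa
  have hW0 : 0 < w R + ‖u₀‖ := add_pos_of_pos_of_nonneg (hu0.trans_le huw) (norm_nonneg _)
  have hWle : w R + ‖u₀‖ ≤ Real.sqrt θ * Real.sqrt R + ‖u₀‖ := by linarith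
  refine ⟨⌈R / σ⌉₊ + ⌈64 * R ^ 3⌉₊ + 2, fun N hN Φ K hKge hbudget i => ?_⟩
  -- sizes of N
  have hNcast : ((⌈R / σ⌉₊ : ℕ) : ℝ) + ((⌈64 * R ^ 3⌉₊ : ℕ) : ℝ) + 2 ≤ N := by exact_mod_cast hN
  have hNR : R / σ + 1 ≤ (N : ℝ) := by
    have h1 : R / σ ≤ ⌈R / σ⌉₊ := Nat.le_ceil _
    linarith [(Nat.cast_nonneg ⌈64 * R ^ 3⌉₊ : (0 : ℝ) ≤ _)]
  have hN64 : 64 * R ^ 3 < (N : ℝ) + 1 := by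
    have h1 : 64 * R ^ 3 ≤ ⌈64 * R ^ 3⌉₊ := Nat.le_ceil _
    linarith [(Nat.cast_nonneg ⌈R / σ⌉₊ : (0 : ℝ) ≤ _)]
  have hKle : (K : ℝ) ≤ R / σ := by
    rw [le_div_iff₀ hσ]
    have h1 : 0 ≤ (u R + w R + 2 * ‖u₀‖) * T :=
      mul_nonneg (by linarith [norm_nonneg u₀, hu0.le]) hT.le
    nlinarith
  have hKN : K + 1 ≤ N := by
    have : (K : ℝ) + 1 ≤ N := by linarith
    exact_mod_cast this
  have hℓ := TrueCaps.ell_pos N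
  have hℓ1 := ell_le_one N
  -- slabs
  obtain ⟨S, hSdef⟩ : ∃ S : ℕ, S = ⌈48 * (w R + ‖u₀‖) * T⌉₊ + 1 := ⟨_, rfl⟩
  have hS0 : 0 < S := by rw [hSdef]; exact Nat.succ_pos _
  have hSle : (S : ℝ) ≤ 48 * (w R + ‖u₀‖) * T + 2 := by
    rw [hSdef]; push_cast
    linarith [(Nat.ceil_lt_add_one (by positivity : (0 : ℝ) ≤ 48 * (w R + ‖u₀‖) * T)).le]
  have hSge : 48 * (w R + ‖u₀‖) * T ≤ S := by
    rw [hSdef]; push_cast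
    linarith [Nat.le_ceil (48 * (w R + ‖u₀‖) * T)]
  have hSreal : (0 : ℝ) < S := by exact_mod_cast hS0
  -- radii at scale ℓ
  obtain ⟨δN, hδNdef⟩ : ∃ δN : ℝ, δN = (2 * σ + 3 * (w R + ‖u₀‖) * T / S) * ell N := ⟨_, rfl⟩
  obtain ⟨ρN, hρNdef⟩ : ∃ ρN : ℝ, ρN = 2 * R * ell N := ⟨_, rfl⟩
  have hd : 2 * σ + 3 * (w R + ‖u₀‖) * T / S ≤ 1 / 8 := by
    have h1 : 3 * (w R + ‖u₀‖) * T / S ≤ 1 / 16 := by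
      rw [div_le_iff₀ hSreal]
      nlinarith
    linarith
  have hd0 : 0 ≤ 2 * σ + 3 * (w R + ‖u₀‖) * T / S := by positivity
  have hδN0 : 0 ≤ δN := by rw [hδNdef]; positivity
  have hδNlt : δN < 1 / 2 := by
    rw [hδNdef]
    calc (2 * σ + 3 * (w R + ‖u₀‖) * T / S) * ell N ≤ 1 / 8 * 1 :=
          mul_le_mul hd hℓ1 hℓ.le (by norm_num)
      _ < 1 / 2 := by norm_num
  have hρN0 : 0 ≤ ρN := by rw [hρNdef]; positivity
  have hρNlt : ρN < 1 / 2 := by rw [hρNdef]; exact two_mul_ell_lt_half hN64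
  have hcube : ∀ x : ℝ, ((N : ℝ) + 1) * (x * ell N) ^ 3 = x ^ 3 := by
    intro x
    rw [mul_pow, ← mul_assoc, mul_comm ((N : ℝ) + 1), mul_assoc, succ_mul_ell_pow_three, mul_one]
  have h8δ : 8 * ((N : ℝ) + 1) * δN ^ 3 ≤ 1 / 64 := by
    rw [hδNdef, mul_assoc, hcube]
    have : (2 * σ + 3 * (w R + ‖u₀‖) * T / S) ^ 3 ≤ (1 / 8 : ℝ) ^ 3 := pow_le_pow_left₀ hd0 hd 3
    nlinarith
  have h8ρ : 8 * ((N : ℝ) + 1) * ρN ^ 3 = 64 * R ^ 3 := by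
    rw [hρNdef, show 2 * R * ell N = (2 * R) * ell N by ring, mul_assoc, hcube]; ring
  -- probability space
  have hprob : IsProbabilityMeasure (gibbs σ a θ u₀ N Φ) :=
    isProbabilityMeasure_localGibbsLaw continuous_const continuous_const continuous_const
      (fun _ => ha) (fun _ => hθ) hσhalf N Φ
  -- the degenerate case: fewer links than slabs
  by_cases hSK : K + 1 < S
  · have hhyp : R / (4 * σ) ≤ (S : ℝ) * (((0 : ℕ) : ℝ) + 2) := by
      have : (K : ℝ) + 1 ≤ S := by exact_mod_cast hSK.le
      push_cast
      linarith
    have key := hA' R hRR₁ S 0 (w R + ‖u₀‖) hW0.le hWle hSle hhyp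
    have hone : gibbs σ a θ u₀ N Φ {z | IsTightChain σ T N Φ (w R + ‖u₀‖) K z i ∧
        ¬ IsHot σ T N Φ u₀ (u R) (R + haloMargin u₀ σ T (u R)) z i} ≤ 1 :=
      (measure_mono (Set.subset_univ _)).trans (le_of_eq hprob.measure_univ)
    refine hone.trans ?_
    rw [← ENNReal.ofReal_one]
    refine ENNReal.ofReal_le_ofReal (le_trans ?_ key)
    have hS1 : (1 : ℝ) ≤ S := by exact_mod_cast hS0
    have hR3 : (1 : ℝ) ≤ 64 * R ^ 3 + 1 := by linarith [pow_nonneg hR0 3]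
    simp only [pow_zero, mul_one, Nat.cast_zero, add_zero]
    calc (1 : ℝ) ≤ 4 * 1 * 1 := by norm_num
      _ ≤ 4 * (S : ℝ) * (64 * R ^ 3 + 1) := by gcongr
  -- the main case
  push Not at hSK
  obtain ⟨r₀, hr₀def⟩ : ∃ r₀ : ℕ, r₀ = (K + 1) / S - 1 := ⟨_, rfl⟩
  have hdiv1 : 1 ≤ (K + 1) / S := (Nat.le_div_iff_mul_le hS0).2 (by simpa using hSK)
  have hr₀1 : r₀ + 1 = (K + 1) / S := by rw [hr₀def]; omega
  have hSr : S * (r₀ + 1) ≤ K + 1 := by rw [hr₀1]; exact Nat.mul_div_le (K + 1) S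
  have hSr2 : R / (4 * σ) ≤ (S : ℝ) * ((r₀ : ℝ) + 2) := by
    have h1 : K + 1 < S * (r₀ + 2) := by
      rw [show r₀ + 2 = (K + 1) / S + 1 by omega, Nat.mul_add, mul_one, mul_comm]
      exact Nat.lt_div_mul_add hS0
    have h2 : (K : ℝ) + 1 < (S : ℝ) * ((r₀ : ℝ) + 2) := by exact_mod_cast h1
    linarith
  have hr₀N : r₀ + 1 ≤ N := by
    have : r₀ + 1 ≤ K + 1 := by
      calc r₀ + 1 = (K + 1) / S := hr₀1
        _ ≤ K + 1 := Nat.div_le_self _ _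
    omega
  -- covering by the slab events
  have hcover : {z : Phase N | IsTightChain σ T N Φ (w R + ‖u₀‖) K z i ∧
        ¬ IsHot σ T N Φ u₀ (u R) (R + haloMargin u₀ σ T (u R)) z i} ⊆
      Φ.goodᶜ ∪ ⋃ s ∈ Finset.range S, {z | NearChain N Φ (T * ell N * ((s : ℝ) + 1) / S) r₀ δN ρN z i} := by
    intro z hz
    by_cases hgood : z ∈ Φ.good
    · obtain ⟨hchain, hhot⟩ := hz
      have H := cap_of_not_isHot Φ hgood hhot
      obtain ⟨s, hs, hnear⟩ := hC σ T R (u R) (w R) u₀ N K S r₀ Φ z i hgood hσ hT hu0 huw hS0 hSr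
        hbudget hchain H
      refine Or.inr (Set.mem_iUnion₂.2 ⟨s, Finset.mem_range.2 hs, ?_⟩)
      rw [hδNdef, hρNdef]
      exact hnear
    · exact Or.inl hgood
  have hslab : ∀ s ∈ Finset.range S,
      gibbs σ a θ u₀ N Φ {z | NearChain N Φ (T * ell N * ((s : ℝ) + 1) / S) r₀ δN ρN z i} ≤
        ENNReal.ofReal (4 * (1 / 32) ^ r₀ * (64 * R ^ 3 + r₀ + 1)) := by
    intro s _
    refine (hB σ a θ u₀ hsd ha hθ N r₀ hr₀N Φ _ δN ρN hδN0 hδNlt hρN0 hρNlt i).trans ?_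
    -- rewrite the ℝ≥0∞ bound as `ofReal` of a real number and compare
    have e1 : (2 : ℝ≥0∞) ^ (r₀ + 2) = ENNReal.ofReal ((2 : ℝ) ^ (r₀ + 2)) := by
      rw [ENNReal.ofReal_pow (by norm_num), ENNReal.ofReal_ofNat]
    have e2 : ENNReal.ofReal (8 * (N + 1) * δN ^ 3) ^ r₀ = ENNReal.ofReal ((8 * (N + 1) * δN ^ 3) ^ r₀) :=
      (ENNReal.ofReal_pow (by positivity) r₀).symm
    have e3 : ENNReal.ofReal (8 * (N + 1) * ρN ^ 3) + r₀ + 1 =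
        ENNReal.ofReal (8 * (N + 1) * ρN ^ 3 + r₀ + 1) := by
      rw [ENNReal.ofReal_add (by positivity) zero_le_one,
        ENNReal.ofReal_add (by positivity) (Nat.cast_nonneg _), ENNReal.ofReal_natCast, ENNReal.ofReal_one]
    rw [e1, e2, e3, ← ENNReal.ofReal_mul (by positivity), ← ENNReal.ofReal_mul (by positivity)]
    refine ENNReal.ofReal_le_ofReal ?_
    rw [h8ρ]
    have hx0 : 0 ≤ 8 * ((N : ℝ) + 1) * δN ^ 3 := by positivity
    have hpow : (8 * ((N : ℝ) + 1) * δN ^ 3) ^ r₀ ≤ (1 / 64 : ℝ) ^ r₀ := pow_le_pow_left₀ hx0 h8δ r₀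
    have hsplit : (2 : ℝ) ^ (r₀ + 2) * (1 / 64 : ℝ) ^ r₀ = 4 * (1 / 32) ^ r₀ := by
      rw [pow_add, show (2 : ℝ) ^ 2 = 4 by norm_num, mul_comm _ (4 : ℝ), mul_assoc, ← mul_pow]
      norm_num
    have hposR : 0 ≤ 64 * R ^ 3 + (r₀ : ℝ) + 1 := by positivity
    calc (2 : ℝ) ^ (r₀ + 2) * (8 * ((N : ℝ) + 1) * δN ^ 3) ^ r₀ * (64 * R ^ 3 + r₀ + 1)
        ≤ (2 : ℝ) ^ (r₀ + 2) * (1 / 64 : ℝ) ^ r₀ * (64 * R ^ 3 + r₀ + 1) := by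
          gcongr
      _ = 4 * (1 / 32) ^ r₀ * (64 * R ^ 3 + r₀ + 1) := by rw [hsplit]
  have key := hA' R hRR₁ S r₀ (w R + ‖u₀‖) hW0.le hWle hSle hSr2
  calc gibbs σ a θ u₀ N Φ {z : Phase N | IsTightChain σ T N Φ (w R + ‖u₀‖) K z i ∧
          ¬ IsHot σ T N Φ u₀ (u R) (R + haloMargin u₀ σ T (u R)) z i}
      ≤ gibbs σ a θ u₀ N Φ (Φ.goodᶜ ∪ ⋃ s ∈ Finset.range S,
          {z | NearChain N Φ (T * ell N * ((s : ℝ) + 1) / S) r₀ δN ρN z i}) := measure_mono hcover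
    _ ≤ gibbs σ a θ u₀ N Φ Φ.goodᶜ +
          gibbs σ a θ u₀ N Φ (⋃ s ∈ Finset.range S, {z | NearChain N Φ (T * ell N * ((s : ℝ) + 1) / S) r₀ δN ρN z i}) :=
        measure_union_le _ _
    _ ≤ 0 + ∑ s ∈ Finset.range S,
          gibbs σ a θ u₀ N Φ {z | NearChain N Φ (T * ell N * ((s : ℝ) + 1) / S) r₀ δN ρN z i} := by
        refine add_le_add (le_of_eq ?_) (measure_biUnion_finset_le _ _)
        exact gibbs_absolutelyContinuous σ a θ u₀ N Φ Φ.measure_compl_good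
    _ ≤ 0 + ∑ _s ∈ Finset.range S, ENNReal.ofReal (4 * (1 / 32) ^ r₀ * (64 * R ^ 3 + r₀ + 1)) := by
        gcongr with s hs
        exact hslab s hs
    _ = ENNReal.ofReal ((S : ℝ) * (4 * (1 / 32) ^ r₀ * (64 * R ^ 3 + r₀ + 1))) := by
        rw [zero_add, Finset.sum_const, Finset.card_range, nsmul_eq_mul, ← ENNReal.ofReal_natCast,
          ← ENNReal.ofReal_mul (Nat.cast_nonneg _)]
    _ ≤ ENNReal.ofReal η := by
        refine ENNReal.ofReal_le_ofReal ?_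
        calc (S : ℝ) * (4 * (1 / 32) ^ r₀ * (64 * R ^ 3 + r₀ + 1))
            = 4 * (S : ℝ) * (1 / 32) ^ r₀ * (64 * R ^ 3 + r₀ + 1) := by ring
          _ ≤ η := key

/-- **Registered stub `stub_tightChainTail`** of the first-moment line: the first-moment tight-chain tail, assembled
from the three landed sub-stubs by `tightChainTail_of`. -/
theorem stub_tightChainTail : TightChainTail :=
  tightChainTail_of stub_nearChainBound stub_nearChainOfChain stub_tailArith

end

end Summit.AtomisticToContinuum.HydrodynamicLimit.Theorems.TrueAnchoredInfection
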